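import Literature.Computability.Complexity.UniformDerandomizationRSRWrap
import Literature.Computability.Complexity.TVSelfCorrectCoins
import HarnessLib

/-!
# The random self-reduction bridge for Trevisan–Vadhan's `F`: from a strong construction of
# APPROXIMATE circuits to a strong construction of EXACT circuits (IW98 Def. 5, `C^{F,1−ρ} → C^F`)

Literature / complexity — derandomization under a uniform assumption (Case 2 of IW98 in TV07 form).
Impagliazzo–Wigderson's Lemmas 14/18 deliver a strong construction (Def. 4) of circuits that are only
APPROXIMATELY correct (`IWUniform.approxCircuits Ev f ρ`, `UniformDerandomizationSelectByTesting.lean`),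
while the bootstrapping of Lemma 16 (`IWBootstrapping.lean`) consumes EXACT circuits
(`IWUniform.Bootstrap.circuitsFor`). The passage is Def. 5 — "`f` is random self-reducible if
`C^{f,1−n^{−c}} → C^f`" — which for Trevisan–Vadhan's `F = FB` is the self-correction of
`TVSelfCorrect*.lean` (TV07 Lemma 3.5): append fresh coins to the approximate description and read it
through the corrected-majority evaluator. This file proves that passage for strong constructions given as
truth-table transducers (the form the pipeline produces, `UniformDerandomizationTransducers.lean`), with
the wrapper of `UniformDerandomizationRSRWrap.lean` and the failure bound of `TVSelfCorrectCoins.lean`: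

* `IWUniform.rsrRho` — the accuracy the corrector needs: `ρ(k) = 1/(64 · blk n · (Dn n + 1)²)` for
  `n = nOf k`; `IWUniform.coinPoly` — a polynomial bound on the corrector's coins;
* **`IWUniform.stronglyConstructible_circuitsFor_of_ttFnL`** — if `ttFnAlgL Q q G` strongly constructs
  `approxCircuits Ev FB rsrRho` and the evaluator `Ev'` reads a description `⟨d, ⟨1ᵃ, coins⟩⟩` as the
  `8·2a`-fold corrected majority of `y ↦ (Ev ⟨d, y⟩ = 1)` (hypothesis `hspec`, the machine content of `Ev'`,
  to be discharged by its `FP` construction) and answers `0` off the canonical lengths (`hspec0`), then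
  `circuitsFor Ev' FB` is strongly constructible using `FB`: the transducer
  `ttFnAlgL (qryF Q q p) (q ∘ 2X) (outF Q G q p)` succeeds with probability `≥ 1 − 1/a`
  (`1/(2a)` for the given construction run at accuracy `2a`, `1/(2a)` for the corrector's coins).

Everything is proved; the two definitions are explicit (no named facts).

## References

* [ImpagliazzoWigderson2001] R. Impagliazzo, A. Wigderson, JCSS 63 (2001), §2.2 Defs. 3–5, Lemma 16.
* [TrevisanVadhan2007] L. Trevisan, S. Vadhan, Comput. Complexity 16 (2007), Lemmas 3.5–3.6, Thm. 4.3.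
-/

noncomputable section

namespace Literature.Computability.Complexity

namespace IWUniform

open _root_.Computability Polynomial Finset QBFUniv RSRWrap

open scoped Classical

/-- **The accuracy the corrector needs** at length `k` (size `n = nOf k`). [cite: ImpagliazzoWigderson2001, Def. 5] -/
def rsrRho (k : ℕ) : ℝ := 1 / ((64 * blk (nOf k) * (Dn (nOf k) + 1) ^ 2 : ℕ) : ℝ)

/-- A polynomial bound on the corrector's coins in terms of `k + a`. [folklore] -/
def coinPoly : Polynomial ℕ := 528 * (X + 3) ^ 3

/-- The corrector's coins are polynomially many: `coinsLen n i a ≤ coinPoly (h n i + a)`. [folklore] -/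
theorem coinsLen_le (n i a : ℕ) : coinsLen n i a ≤ coinPoly.eval (h n i + a) := by
  have hpad : padLen n i ≤ h n i := by rw [padLen]; omega
  have hpt : ptLen n ≤ h n i := by rw [h]; omega
  have htr : trialLen n i ≤ 33 * (h n i + 3) ^ 2 := by
    rw [trialLen, linesOf]
    nlinarith
  simp only [coinPoly, eval_mul, eval_pow, eval_add, eval_X, eval_ofNat]
  rw [coinsLen, trialsOf]
  calc 8 * (2 * a) * trialLen n i ≤ 16 * (h n i + a + 3) * (33 * (h n i + 3) ^ 2) :=
        Nat.mul_le_mul (by omega) htr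
    _ ≤ 528 * (h n i + a + 3) ^ 3 := by
        have : (h n i + 3) ^ 2 ≤ (h n i + a + 3) ^ 2 := Nat.pow_le_pow_left (by omega) 2
        nlinarith

/-- The last canonical length of a size is `h n 0 = pre (n + 1) − 1`; so a canonical-test-passing length
is exactly some `h n i`. [folklore] -/
theorem h_nOf_iOf_eq {k : ℕ} (hc : ptLen (nOf k) + blk (nOf k) ≤ k - pre (nOf k)) : h (nOf k) (iOf k) = k := by
  rcases h_nOf_iOf (List.replicate k false) (by simpa using hc) with h1 | ⟨-, h2⟩
  · simpa using h1
  · exfalso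
    have := (nOf_spec k).2
    simp only [List.length_replicate] at h2
    rw [pre, slot] at this
    rw [h] at h2
    omega

/-- **The random self-reduction bridge** (IW98 Def. 5 for Trevisan–Vadhan's `F`, transducer form).
[cite: ImpagliazzoWigderson2001, Defs. 4–5] [cite: TrevisanVadhan2007, Lemma 3.5] -/
theorem stronglyConstructible_circuitsFor_of_ttFnL {Ev Ev' Q G : List Bool → List Bool} (hQ : Q ∈ FP) (hG : G ∈ FP)
    (q p : Polynomial ℕ)
    (hA : ∀ (k a : ℕ), 1 ≤ a → ∀ O : Oracle, AgreesOn O FB k →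
      1 - 1 / (a : ℝ) ≤ uniformProb (p.eval (k + a)) {r | ttFnL Q q G O (strongInput k a r) ∈ approxCircuits Ev FB rsrRho k})
    (hspec : ∀ (n i : ℕ), i ≤ mlen n → ∀ (d : List Bool) (a : ℕ) (c w : List Bool), w.length = h n i →
        coinsLen n i a ≤ c.length →
        Ev' (boolPair (boolPair d (boolPair (ones a) c)) w) =
          [majCorrected (descFn Ev d) n (decodeTrials n i (trialsOf (2 * a)) c) w])
    (hspec0 : ∀ (d' w : List Bool), ¬ (ptLen (nOf w.length) + blk (nOf w.length) ≤ w.length - pre (nOf w.length)) →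
        Ev' (boolPair d' w) = [false]) :
    StronglyConstructibleUsing (Bootstrap.circuitsFor Ev' FB) FB id := by
  refine stronglyConstructibleUsing_of_ttFnL (qryF_mem_FP Q q p hQ) (outF_mem_FP G q p hG) (q.comp (2 * X))
    (p.comp (2 * X) + coinPoly) fun k a ha O hO => ?_
  set L := (p.comp (2 * X) + coinPoly).eval (k + a) with hLdef
  set m := p.eval (k + 2 * a) with hmdef
  have hmL : m ≤ L := by
    rw [hLdef, hmdef, eval_add, eval_comp, eval_mul, eval_ofNat, eval_X]
    exact (eval_mono_nat p (by omega)).trans (Nat.le_add_right _ _)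
  -- the output of the wrapped transducer
  have hout : ∀ r : List Bool, ttFnL (qryF Q q p) (q.comp (2 * X)) (outF G q p) O (strongInput k a r) =
      boolPair (ttFnL Q q G O (phiF p (strongInput k a r))) (boolPair (ones a) (r.drop m)) := fun r => ttFnL_wrap Q G q p O k a r
  by_cases hc : ptLen (nOf k) + blk (nOf k) ≤ k - pre (nOf k)
  swap
  · -- non-canonical length: `F ≡ 0` there and `Ev'` answers `0`
    have hall : uniformProb L {r | ttFnL (qryF Q q p) (q.comp (2 * X)) (outF G q p) O (strongInput k a r) ∈
        Bootstrap.circuitsFor Ev' FB k} = 1 := by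
      rw [← uniformProb_univ L]
      congr 1
      ext r
      simp only [Set.mem_setOf_eq, Set.mem_univ, iff_true]
      rw [hout]
      intro y hy
      have hc' : ¬ (ptLen (nOf y.length) + blk (nOf y.length) ≤ y.length - pre (nOf y.length)) := by rwa [hy]
      rw [hspec0 _ y hc', FB, if_neg hc']
    rw [hall]
    have : (0 : ℝ) ≤ 1 / a := by positivity
    linarith
  -- canonical length `k = h n i`
  set n := nOf k with hndef
  set i := iOf k with hidef
  have hk : h n i = k := h_nOf_iOf_eq hc
  have hi : i ≤ mlen n := iOf_le k
  -- the good prefixes: the given construction lands in the approximate circuits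
  set Good : Set (List Bool) := {r₁ | ttFnL Q q G O (strongInput k (2 * a) r₁) ∈ approxCircuits Ev FB rsrRho k} with hGood
  have hGoodprob : 1 - 1 / (2 * a : ℝ) ≤ uniformProb m Good := by
    have := hA k (2 * a) (by omega) O hO
    push_cast at this
    exact this
  -- failure events
  set F₁ : Set (List Bool) := {r | r.take m ∉ Good} with hF₁
  set F₂ : Set (List Bool) := {r | r.take m ∈ Good ∧ ∃ w : List Bool, w.length = h n i ∧
      majCorrected (descFn Ev (ttFnL Q q G O (strongInput k (2 * a) (r.take m)))) n
        (decodeTrials n i (trialsOf (2 * a)) (r.drop m)) w ≠ FB w} with hF₂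
  have hF₁prob : uniformProb L F₁ ≤ 1 / (2 * a : ℝ) := by
    obtain ⟨e, he⟩ := Nat.exists_eq_add_of_le hmL
    have : F₁ = {r | r.take m ∈ Goodᶜ} := by ext r; simp [hF₁]
    rw [this, he, uniformProb_take_event, uniformProb_compl]
    linarith
  have hF₂prob : uniformProb L F₂ ≤ 1 / (2 * a : ℝ) := by
    obtain ⟨e, he⟩ := Nat.exists_eq_add_of_le hmL
    rw [he]
    refine uniformProb_add_le_of_fibre fun Y hY => ?_
    by_cases hYg : Y ∈ Good
    · have hd : ttFnL Q q G O (strongInput k (2 * a) Y) ∈ approxCircuits Ev FB rsrRho (h n i) := by rw [hk]; exact hYg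
      have hρ : rsrRho (h n i) ≤ 1 / ((64 * blk n * (Dn n + 1) ^ 2 : ℕ) : ℝ) := by rw [hk, rsrRho]
      have hcoins : coinsLen n i a ≤ e := by
        have h1 := coinsLen_le n i a
        rw [hk] at h1
        have hmono : p.eval (k + 2 * a) ≤ p.eval (2 * (k + a)) := eval_mono_nat p (by omega)
        have h2 : coinPoly.eval (k + a) + m ≤ L := by
          rw [hLdef, hmdef, eval_add, eval_comp, eval_mul, eval_ofNat, eval_X]; omega
        omega
      refine le_trans (le_of_eq ?_) (uniformProb_majCorrected_ne_le hi hd hρ ha (L := e) hcoins)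
      congr 1
      ext v
      simp only [Set.mem_setOf_eq, hF₂]
      rw [List.take_left' hY, List.drop_left' hY]
      exact ⟨fun h' => h'.2, fun h' => ⟨hYg, h'⟩⟩
    · refine le_trans (le_of_eq ?_) (by positivity : (0 : ℝ) ≤ 1 / (2 * a : ℝ))
      rw [← uniformProb_empty e]
      congr 1
      ext v
      simp only [Set.mem_setOf_eq, hF₂, Set.mem_empty_iff_false, iff_false, not_and]
      intro hv
      rw [List.take_left' hY] at hv
      exact absurd hv hYg
  -- assembling: off `F₁ ∪ F₂` the output is an exact circuit
  have hcoinsL : coinsLen n i a ≤ L - m := by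
    have h1 := coinsLen_le n i a
    rw [hk] at h1
    have hmono : p.eval (k + 2 * a) ≤ p.eval (2 * (k + a)) := eval_mono_nat p (by omega)
    have h2 : coinPoly.eval (k + a) + m ≤ L := by
      rw [hLdef, hmdef, eval_add, eval_comp, eval_mul, eval_ofNat, eval_X]; omega
    omega
  set S : Set (List Bool) := {r | ttFnL (qryF Q q p) (q.comp (2 * X)) (outF G q p) O (strongInput k a r) ∈
      Bootstrap.circuitsFor Ev' FB k} with hS
  have himp : ∀ r : List Bool, r.length = L → r ∈ Sᶜ → r ∈ F₁ ∨ r ∈ F₂ := by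
    intro r hr hrS
    by_contra hno
    rw [not_or] at hno
    obtain ⟨h1, h2⟩ := hno
    have hg : r.take m ∈ Good := by simpa [hF₁] using h1
    apply hrS
    simp only [hS, Set.mem_setOf_eq, hout r, phiF_apply]
    intro y hy
    have hy' : y.length = h n i := by rw [hk, hy]
    have hlen : coinsLen n i a ≤ (r.drop m).length := by rw [List.length_drop, hr]; exact hcoinsL
    rw [hspec n i hi _ a _ y hy' hlen]
    by_contra hne
    apply h2
    simp only [hF₂, Set.mem_setOf_eq]
    refine ⟨hg, y, hy', fun heq => hne ?_⟩
    rw [heq]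
  have hSc : uniformProb L Sᶜ ≤ 1 / (a : ℝ) := by
    refine (uniformProb_le_add_of_imp himp).trans ?_
    have ha' : (0 : ℝ) < a := by exact_mod_cast ha
    calc uniformProb L F₁ + uniformProb L F₂ ≤ 1 / (2 * a : ℝ) + 1 / (2 * a : ℝ) := add_le_add hF₁prob hF₂prob
      _ = 1 / (a : ℝ) := by field_simp; ring
  have := uniformProb_compl L S
  have hle1 := uniformProb_le_one L Sᶜ
  show 1 - 1 / (a : ℝ) ≤ uniformProb L S
  linarith

end IWUniform

end Literature.Computability.Complexity

end
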